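import Mathlib.RingTheory.MvPolynomial.Symmetric.NewtonIdentities
import Mathlib.Combinatorics.Enumerative.Partition.Basic
import Mathlib.Algebra.BigOperators.Ring.Finset
import HarnessLib

/-!
# Route `DepthWindow`, g7 — the algebraic core of LST homogenisation (Lemma 11): elementary
symmetric polynomials are `ℚ`-combinations of power-sum monomials

The print homogenisation `HomRel 1 2` (Limaye–Srinivasan–Tavenas, Lemma 11: one inhomogeneous
product layer ↦ two homogeneous product layers, size `poly · 2^{O(d)}`) rests on ONE algebraic
fact: over a `ℚ`-algebra, `e_k = Σ_{μ ⊢ k} c_μ · p_μ` with `p_μ = Π_j p_{μ_j}` (Newton's identities,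
solved for `e_k`; `p(k)` terms).  Applied to the factors `A_i` of a product gate `Π_i (1 + A_i)` it
writes the gate as `Σ_k Σ_{μ ⊢ k} c_{k,μ} Π_{j ∈ μ} (Σ_i A_i^j)` — a sum of products of POWER SUMS of
the `A_i`, i.e. two product layers (`A_i^j` inside the power sums, the product over the parts of `μ`
outside), every intermediate gate homogeneous once the `A_i` are split into weight components.
This module proves exactly that core, def-free and route-independent:

* `esymm_mem_span_psumPart`     — `esymm σ R k ∈ span_ℚ {psumPart σ R μ : μ ⊢ k}` (strong induction on
                                   Mathlib's `MvPolynomial.mul_esymm_eq_sum`);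
* `exists_esymm_eq_sum_psumPart` — the same with an explicit coefficient function;
* `prod_one_add_eq_sum_aeval_esymm` — `Π_i (1 + A_i) = Σ_{k ≤ |σ|} e_k(A)` for elements of any
                                   commutative ring;
* `prod_one_add_eq_sum_psum_form` — the depth-two power-sum form of `Π_i (1 + A_i)` over a
                                   commutative `ℚ`-algebra (the statement the `HomRel 1 2` port uses).
[cite: LimayeSrinivasanTavenas2025, Lemma 11]
-/

-- layout Summits/ValiantsHypothesis/ValiantsHypothesis forces the duplicated namespace component
set_option linter.dupNamespace false

namespace Summit.ValiantsHypothesis.ValiantsHypothesis.Theorems.DepthWindow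

open MvPolynomial Finset

section NewtonSpan

variable (σ : Type*) [Fintype σ] (R : Type*) [CommRing R]

/-- Multiplying a power-sum monomial of weight `m` by `p_j`, `j > 0`, gives a power-sum monomial of
weight `j + m`. [folklore] -/
theorem psum_mul_psumPart_mem_range {m j : ℕ} (hj : 0 < j) (μ : m.Partition) :
    psum σ R j * psumPart σ R μ ∈ Set.range (fun ν : (j + m).Partition => psumPart σ R ν) := by
  refine ⟨⟨j ::ₘ μ.parts, fun {i} hi => ?_, ?_⟩, ?_⟩
  · rcases Multiset.mem_cons.1 hi with rfl | hi
    · exact hj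
    · exact μ.parts_pos hi
  · rw [Multiset.sum_cons, μ.parts_sum]
  · simp [psumPart, Multiset.map_cons, Multiset.prod_cons]

variable [Algebra ℚ R]

/-- **`e_k` is a `ℚ`-combination of the power-sum monomials `p_μ`, `μ ⊢ k`** (Newton's identities
solved for `e_k`; the cycle-index formula without its explicit coefficients).
[cite: LimayeSrinivasanTavenas2025, Lemma 11] -/
theorem esymm_mem_span_psumPart (k : ℕ) :
    esymm σ R k ∈ Submodule.span ℚ (Set.range (fun μ : k.Partition => psumPart σ R μ)) := by
  induction k using Nat.strong_induction_on with
  | _ k ih =>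
    rcases Nat.eq_zero_or_pos k with rfl | hk
    · refine Submodule.subset_span ⟨Nat.Partition.indiscrete 0, ?_⟩
      simp [esymm_zero]
    · -- `esymm k = (1/k) • (k * esymm k)` and Newton's identity for `k * esymm k`
      have hsmul : esymm σ R k =
          (k : ℚ)⁻¹ • ((k : MvPolynomial σ R) * esymm σ R k) := by
        rw [← nsmul_eq_mul, ← Nat.cast_smul_eq_nsmul ℚ,
          inv_smul_smul₀ (Nat.cast_ne_zero.2 hk.ne')]
      rw [hsmul, mul_esymm_eq_sum σ R k]
      refine Submodule.smul_mem _ _ ?_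
      -- `(-1)^(k+1) * Σ …` : a sign times a sum of signed terms `esymm a.1 * psum a.2`
      have hsign : ∀ (n : ℕ) (y : MvPolynomial σ R),
          y ∈ Submodule.span ℚ (Set.range (fun μ : k.Partition => psumPart σ R μ)) →
          (-1) ^ n * y ∈ Submodule.span ℚ (Set.range (fun μ : k.Partition => psumPart σ R μ)) := by
        intro n y hy
        rcases neg_one_pow_eq_or (MvPolynomial σ R) n with h | h
        · simpa [h] using hy
        · simpa [h] using Submodule.neg_mem _ hy
      refine hsign _ _ (Submodule.sum_mem _ fun a ha => ?_)
      simp only [mem_filter, mem_antidiagonal] at ha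
      obtain ⟨hsum, hlt⟩ := ha
      rw [mul_assoc]
      refine hsign _ _ ?_
      -- `esymm a.1 ∈ span {psumPart μ : μ ⊢ a.1}` (induction), times `psum a.2`, `a.2 > 0`
      have ha2 : 0 < a.2 := by omega
      have hk' : a.2 + a.1 = k := by omega
      have hih := ih a.1 hlt
      refine Submodule.span_induction (p := fun x _ => x * psum σ R a.2 ∈
          Submodule.span ℚ (Set.range (fun μ : k.Partition => psumPart σ R μ))) ?_ ?_ ?_ ?_ hih
      · rintro x ⟨μ, rfl⟩
        refine Submodule.subset_span ?_
        rw [mul_comm, ← hk']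
        exact psum_mul_psumPart_mem_range σ R ha2 μ
      · simp
      · intro x y _ _ hx hy
        rw [add_mul]; exact Submodule.add_mem _ hx hy
      · intro c x _ hx
        rw [smul_mul_assoc]; exact Submodule.smul_mem _ c hx

/-- `e_k = Σ_{μ ⊢ k} c_μ • p_μ` for some rational coefficients `c_μ`.
[cite: LimayeSrinivasanTavenas2025, Lemma 11] -/
theorem exists_esymm_eq_sum_psumPart (k : ℕ) :
    ∃ c : k.Partition → ℚ, esymm σ R k = ∑ μ, c μ • psumPart σ R μ := by
  obtain ⟨c, hc⟩ :=
    (Submodule.mem_span_range_iff_exists_fun ℚ).1 (esymm_mem_span_psumPart σ R k)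
  exact ⟨c, hc.symm⟩

end NewtonSpan

section ProductGate

variable {σ : Type*} [Fintype σ]

/-- `Π_i (1 + A_i) = Σ_{k ≤ |σ|} e_k(A)` in any commutative ring. [folklore] -/
theorem prod_one_add_eq_sum_aeval_esymm {S : Type*} [CommRing S] (A : σ → S) :
    ∏ i, (1 + A i) = ∑ k ∈ range (Fintype.card σ + 1), aeval A (esymm σ ℤ k) := by
  rw [Finset.prod_one_add, ← Finset.card_univ, Finset.powerset_card_disjiUnion,
    Finset.sum_disjiUnion]
  refine Finset.sum_congr rfl fun k _ => ?_
  rw [esymm, map_sum]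
  refine Finset.sum_congr rfl fun t _ => ?_
  rw [map_prod]
  simp

/-- **Depth-two power-sum form of a product gate** over a commutative `ℚ`-algebra:
`Π_i (1 + A_i) = Σ_{k ≤ |σ|} Σ_{μ ⊢ k} c_{k,μ} • Π_{j ∈ μ} (Σ_i A_i ^ j)` — inside: powers and
power sums of the `A_i`; outside: products over the parts of a partition; `p(k)` terms per `k`.
This is the algebra of LST homogenisation (`HomRel 1 2`). [cite: LimayeSrinivasanTavenas2025, Lemma 11] -/
theorem prod_one_add_eq_sum_psum_form {S : Type*} [CommRing S] [Algebra ℚ S] (A : σ → S) :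
    ∃ c : (k : ℕ) → k.Partition → ℚ,
      ∏ i, (1 + A i) = ∑ k ∈ range (Fintype.card σ + 1), ∑ μ : k.Partition,
        c k μ • (μ.parts.map (fun j => ∑ i, A i ^ j)).prod := by
  choose c hc using fun k => exists_esymm_eq_sum_psumPart σ ℚ k
  refine ⟨c, ?_⟩
  have hprod : ∏ i, (1 + A i) = ∑ k ∈ range (Fintype.card σ + 1), aeval A (esymm σ ℚ k) := by
    rw [Finset.prod_one_add, ← Finset.card_univ, Finset.powerset_card_disjiUnion,
      Finset.sum_disjiUnion]
    refine Finset.sum_congr rfl fun k _ => ?_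
    rw [esymm, map_sum]
    refine Finset.sum_congr rfl fun t _ => ?_
    rw [map_prod]
    simp
  rw [hprod]
  refine Finset.sum_congr rfl fun k _ => ?_
  rw [hc k, map_sum]
  refine Finset.sum_congr rfl fun μ _ => ?_
  rw [map_smul, psumPart, map_multiset_prod, Multiset.map_map]
  congr 2
  refine Multiset.map_congr rfl fun j _ => ?_
  simp [psum]

end ProductGate

end Summit.ValiantsHypothesis.ValiantsHypothesis.Theorems.DepthWindow
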